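import Literature.NumberTheory.EllipticCurves.IsogenyFaltingsTraceProofs
import Literature.NumberTheory.GaloisRepresentations.ArtinRepFrobeniusProofs
import Literature.NumberTheory.GaloisRepresentations.LocalOneUnitsProofs
import HarnessLib

/-!
# Faltings' isogeny theorem for elliptic curves over `ℚ` via `a_p`: Čebotarev is not needed

Sibling proof file (theorems only) of `Literature.NumberTheory.EllipticCurves.Isogeny`, third
part of the decomposition of its named fact `WeierstrassCurve.isIsogenous_iff_frobeniusTrace_eq`
(Faltings 1983, §5, Korollar 2 zu Satz 4, elliptic curves over `ℚ`; `IsogenyFrobeniusTraceProofs`: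
(i) ⇒ (iii) unconditionally; `IsogenyFaltingsTraceProofs`: (iii) ⇒ (i) from Satz 3, Korollar 2
and Čebotarev, as printed: "(ii) ⇔ (iii) from Theorem 3 (+ Čebotarev)").

Here the hypothesis **Čebotarev** (`Literature.NumberTheory.Automorphic.chebotarev_artinRep`, a
named fact) is **removed**: the step "(iii) ⇒ equal characters of `V_ℓ E`, `V_ℓ E'`" is proved
from **Frobenius' density theorem** (1896), which is a *theorem* of the tree
(`FramedGaloisRep.infinite_setOf_frobenius_mem_division`,
`GaloisRepresentations/FrobeniusDensityTheorem`;
over `ℚ` in the finite-group form `DeligneSerre1974.exists_frob_eq_pow`,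
`ArtinRepFrobeniusProofs`).  Frobenius' theorem only produces, for `g ∈ Γ_ℚ` and a finite
quotient `φ : Γ_ℚ → Q`, a Frobenius `σ` outside any finite set of primes with `φ σ = φ g ^ k`,
`k` prime to the order of `φ g` (the *division* of `φ g`).  This suffices because at a good prime
`p ≠ ℓ` the whole characteristic polynomial `X² - a_p X + p` of Frobenius on `T_ℓ E` is known
(trace `a_p`, Silverman C.21.3, and determinant `p`, both theorems of the tree:
`trace/det_galoisRepTate_frobenius_of_hasGoodReductionAt_holds`), and for `2 × 2` matrices of
finite order equality of characteristic polynomials passes to all powers and back along a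
division (`Matrix.trace_eq_of_charpoly_pow_eq_fin_two`) — the device of the tree's unconditional
proof of Deligne–Serre's Lemme 3.2 (`DeligneSerre1974.lemma32_complex_holds`), run modulo `ℓⁿ`
for every `n` on the finite quotients `Γ_ℚ → GL₂(ℤ/ℓⁿ) × GL₂(ℤ/ℓⁿ)` of `T_ℓ E × T_ℓ E'`.

## Contents (all proved)

* `Matrix.sq_eq_trace_smul_sub_det_fin_two` (Cayley–Hamilton for `2 × 2` over any commutative
  ring), `Matrix.trace_pow_eq_of_trace_eq_of_det_eq_fin_two` (`tr A = tr B`, `det A = det B` ⇒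
  `tr Aᵐ = tr Bᵐ`), `Matrix.trace_eq_of_charpoly_pow_eq_fin_two` (`A^N = 1 = B^N`, `k ⊥ N`,
  `tr A^k = tr B^k`, `det A^k = det B^k` ⇒ `tr A = tr B`).
* `WeierstrassCurve.trace_galoisRepTate_eq_of_frobenius_eq` — for elliptic curves `E, E'` over
  `ℚ`: if at every arithmetic Frobenius over every prime outside a finite set the traces **and
  determinants** on `T_ℓ E`, `T_ℓ E'` agree, then `tr(g | T_ℓ E) = tr(g | T_ℓ E')` for **all**
  `g ∈ Γ_ℚ` (Frobenius' density theorem, modulo `ℓⁿ` for all `n`).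
* `WeierstrassCurve.isIsogenous_of_finite_setOf_frobeniusTrace_ne_of_satz3_kor2` and the
  assemblies **`WeierstrassCurve.isIsogenous_iff_frobeniusTrace_eq_of_satz3_kor2`**,
  **`WeierstrassCurve.isIsogenous_iff_frobeniusTrace_eq_of_faltings`**: the named fact follows
  from Faltings' Satz 3 (`isSemisimpleRepresentation_rationalGaloisRepTate`) and Korollar 2
  (`isIsogenous_iff_exists_tateModule_hom_ne_zero`), resp. Satz 3 and Satz 4
  (`mem_span_range_tateModule_map_of_equivariant`), for elliptic curves over `ℚ` — its trust base
  is exactly Faltings' two theorems.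

## References

* [Faltings1983Endlichkeit] G. Faltings, Invent. Math. 73 (1983), §5 Satz 3, Satz 4, Kor. 2.
* [Marcus2018] D. A. Marcus, *Number Fields*, Ch. 7, Exercise 12 (f) (Frobenius density theorem).
* [DeligneSerreASENS1974] P. Deligne, J.-P. Serre, *Formes modulaires de poids 1*, Lemme 3.2,
  Rem. 3.3.
* [SilvermanAEC2009] J. H. Silverman, *The Arithmetic of Elliptic Curves*, 2nd ed., C.21
  Remark 21.3, III.§7.

## Design

Pure theorems, no definitions, no instances; the finite quotients `Γ_ℚ →* M₂(ℤ/ℓⁿ)` are built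
inside the proof as composites of monoid homomorphisms (`LinearMap.toMatrixAlgEquiv` in a basis
of the free rank-`2` module `T_ℓ E`, `RingHom.mapMatrix (PadicInt.toZModPow n)`); openness of
their kernels comes from the continuity of `g ↦ [ρ(g)]_b` (`ContinuousRep.continuous_toMatrix`,
`TateModule.isModuleTopology`, `continuous_galoisRepTate_holds`) and of `ℤ_ℓ → ℤ/ℓⁿ`
(`OneUnits.continuous_toZModPow`).
-/

noncomputable section

open scoped NumberField
open IsDedekindDomain Field Literature.NumberTheory.EllipticCurves
  Literature.NumberTheory.GaloisRepresentations Literature.AlgebraicGeometry.Motives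
  Literature.RepresentationTheory.Semisimple

/-! ## `2 × 2` matrices: traces of powers from the characteristic polynomial -/

namespace Matrix

variable {R : Type*} [CommRing R]

/-- **Cayley–Hamilton for `2 × 2` matrices** over any commutative ring:
`A² = (tr A) A - (det A) 1`. [folklore] -/
theorem sq_eq_trace_smul_sub_det_fin_two (A : Matrix (Fin 2) (Fin 2) R) :
    A ^ 2 = A.trace • A - A.det • (1 : Matrix (Fin 2) (Fin 2) R) := by
  ext i j
  rw [sq, trace_fin_two, det_fin_two]
  fin_cases i <;> fin_cases j <;>
    simp [Matrix.mul_apply, Fin.sum_univ_two] <;> ring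

/-- For `2 × 2` matrices over a commutative ring, `tr A = tr B` and `det A = det B` imply
`tr Aᵐ = tr Bᵐ` for all `m` (both trace sequences satisfy the recursion
`t_{m+2} = tr · t_{m+1} - det · t_m`, by Cayley–Hamilton). [folklore] -/
theorem trace_pow_eq_of_trace_eq_of_det_eq_fin_two {A B : Matrix (Fin 2) (Fin 2) R}
    (ht : A.trace = B.trace) (hd : A.det = B.det) (m : ℕ) :
    (A ^ m).trace = (B ^ m).trace := by
  -- the recursion
  have hrec : ∀ (C : Matrix (Fin 2) (Fin 2) R) (m : ℕ),
      (C ^ (m + 2)).trace = C.trace * (C ^ (m + 1)).trace - C.det * (C ^ m).trace := by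
    intro C m
    rw [pow_add, sq_eq_trace_smul_sub_det_fin_two, mul_sub, Matrix.mul_smul, Matrix.mul_smul,
      mul_one, ← pow_succ, trace_sub, trace_smul, trace_smul, smul_eq_mul, smul_eq_mul]
  -- simultaneous induction on two consecutive exponents
  suffices h : (A ^ m).trace = (B ^ m).trace ∧ (A ^ (m + 1)).trace = (B ^ (m + 1)).trace from h.1
  induction m with
  | zero => exact ⟨by rw [pow_zero, pow_zero], by rw [pow_one, pow_one, ht]⟩
  | succ m ih => exact ⟨ih.2, by rw [hrec A m, hrec B m, ht, hd, ih.1, ih.2]⟩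

/-- **Traces along a division.** For `2 × 2` matrices `A, B` over a commutative ring with
`A ^ N = 1 = B ^ N` and `k` prime to `N`: if `A ^ k` and `B ^ k` have the same trace and the same
determinant then `tr A = tr B`. (Choose `k'` with `k k' ≡ 1 (mod N)`; then `A = (A^k)^{k'}`,
`B = (B^k)^{k'}`, and apply `trace_pow_eq_of_trace_eq_of_det_eq_fin_two`.) This is the
matrix step of the tree's unconditional proof of Deligne–Serre, Lemme 3.2
(`DeligneSerre1974.lemma32_complex_holds`), here over an arbitrary commutative ring.
[cite: DeligneSerreASENS1974, Lemme 3.2 and Rem. 3.3] -/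
theorem trace_eq_of_charpoly_pow_eq_fin_two {A B : Matrix (Fin 2) (Fin 2) R} {N k : ℕ}
    (hA : A ^ N = 1) (hB : B ^ N = 1) (hk : k.Coprime N)
    (ht : (A ^ k).trace = (B ^ k).trace) (hd : (A ^ k).det = (B ^ k).det) :
    A.trace = B.trace := by
  rcases Nat.eq_zero_or_pos N with rfl | hN
  · -- `k` coprime to `0` means `k = 1`
    rw [Nat.coprime_zero_right] at hk
    rwa [hk, pow_one, pow_one] at ht
  haveI : NeZero N := ⟨hN.ne'⟩
  -- `k'` with `k k' ≡ 1 (mod N)`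
  set u := ZMod.unitOfCoprime k hk with hu
  obtain ⟨k', hk'⟩ : ∃ k' : ℕ, ((k * k' : ℕ) : ZMod N) = 1 := by
    refine ⟨((u⁻¹ : (ZMod N)ˣ) : ZMod N).val, ?_⟩
    rw [Nat.cast_mul, ZMod.natCast_zmod_val, show ((k : ZMod N)) = (u : ZMod N) from
      (ZMod.coe_unitOfCoprime k hk).symm, Units.mul_inv]
  have hmod : (k * k') % N = 1 % N := by
    rw [← ZMod.natCast_eq_natCast_iff', hk', Nat.cast_one]
  have hpow : ∀ {C : Matrix (Fin 2) (Fin 2) R}, C ^ N = 1 → (C ^ k) ^ k' = C := fun {C} hC ↦ by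
    rw [← pow_mul, pow_eq_pow_mod _ hC, hmod, ← pow_eq_pow_mod _ hC, pow_one]
  rw [← hpow hA, ← hpow hB]
  exact trace_pow_eq_of_trace_eq_of_det_eq_fin_two ht hd k'

end Matrix

namespace WeierstrassCurve

open Rat.HeightOneSpectrum Literature.NumberTheory.GaloisRepresentations.DeligneSerre1974

/-! ## Equal Frobenius characteristic polynomials force equal traces on all of `Γ_ℚ` -/

section Frobenius

variable (ℓ : ℕ) [Fact ℓ.Prime]

/-- The matrix of `ρ_{E,ℓ}` in a `ℤ_ℓ`-basis of `T_ℓ E` depends continuously on `g ∈ Γ_F`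
(`continuous_galoisRepTate_holds`; the profinite topology of `T_ℓ E` is its `ℤ_ℓ`-module
topology, `TateModule.isModuleTopology`). Serre (1968), I.1.1. [folklore] -/
theorem continuous_toMatrix_galoisRepTate {F : Type*} [Field F] (W : WeierstrassCurve F)
    [W.IsElliptic] {n : ℕ} (b : Module.Basis (Fin n) ℤ_[ℓ] (W.tateModule ℓ)) :
    Continuous fun g : absoluteGaloisGroup F ↦ LinearMap.toMatrix b b (W.galoisRepTate ℓ g) := by
  haveI : Module.Finite ℤ_[ℓ] (W.tateModule ℓ) := module_finite_tateModule_holds W ℓ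
  haveI : IsModuleTopology ℤ_[ℓ] (W.tateModule ℓ) :=
    TateModule.isModuleTopology (A := geomPoints W) (p := ℓ)
  exact (W.tateGaloisRep ℓ (continuous_galoisRepTate_holds W ℓ)).continuous_toMatrix b

/-- **Frobenius' density theorem in place of Čebotarev.** Let `E, E'` be elliptic curves over
`ℚ`, `ℓ` a prime and `S` a finite set of primes such that at every arithmetic Frobenius `σ` at
every prime of `\bar ℤ` over every `p ∉ S` the traces *and* the determinants of `σ` on `T_ℓ E`
and `T_ℓ E'` agree. Then `tr(g | T_ℓ E) = tr(g | T_ℓ E')` for every `g ∈ Γ_ℚ`.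
Proof: it suffices to check the congruence modulo `ℓⁿ` for every `n` (`PadicInt.ext_of_toZModPow`).
In bases of the free rank-`2` modules `T_ℓ E`, `T_ℓ E'`, reduction modulo `ℓⁿ` gives
`φₙ : Γ_ℚ → M₂(ℤ/ℓⁿ)ˣ × M₂(ℤ/ℓⁿ)ˣ` with open kernel (continuity of `g ↦ [ρ(g)]`,
`continuous_toMatrix_galoisRepTate`, and of `ℤ_ℓ → ℤ/ℓⁿ`). By Frobenius' density theorem
(`DeligneSerre1974.exists_frob_eq_pow`, from the tree's theorem
`FramedGaloisRep.infinite_setOf_frobenius_mem_division`; Marcus, *Number Fields*, Ch. 7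
Ex. 12 (f)) there is a Frobenius `σ` over some `p ∉ S` with `φₙ σ = φₙ g ^ k`, `k` prime to
the order `N` of `φₙ g`; the reduced matrices of `σ` have equal traces and determinants, hence
so do `[ρ g]ₙ ^ k` and `[ρ' g]ₙ ^ k`, and `Matrix.trace_eq_of_charpoly_pow_eq_fin_two` gives
`tr [ρ g]ₙ = tr [ρ' g]ₙ`. [cite: Marcus2018, Ch. 7, Exercise 12 (f)] -/
theorem trace_galoisRepTate_eq_of_frobenius_eq (W W' : WeierstrassCurve ℚ) [W.IsElliptic]
    [W'.IsElliptic] (S : Finset ℕ)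
    (h : ∀ v : HeightOneSpectrum (𝓞 ℚ), (primesEquiv v : ℕ) ∉ S → ∀ 𝔓 ∈ v.primesAbove,
      ∀ σ : absoluteGaloisGroup ℚ, IsArithFrobAt (𝓞 ℚ) σ 𝔓 →
        LinearMap.trace ℤ_[ℓ] _ (W.galoisRepTate ℓ σ) =
            LinearMap.trace ℤ_[ℓ] _ (W'.galoisRepTate ℓ σ) ∧
          LinearMap.det (W.galoisRepTate ℓ σ) = LinearMap.det (W'.galoisRepTate ℓ σ))
    (g : absoluteGaloisGroup ℚ) :
    LinearMap.trace ℤ_[ℓ] _ (W.galoisRepTate ℓ g) =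
      LinearMap.trace ℤ_[ℓ] _ (W'.galoisRepTate ℓ g) := by
  classical
  have hℓ : ((ℓ : ℕ) : ℚ) ≠ 0 := Nat.cast_ne_zero.mpr (Fact.out : ℓ.Prime).ne_zero
  haveI := module_free_tateModule_holds W ℓ
  haveI := module_finite_tateModule_holds W ℓ
  haveI := module_free_tateModule_holds W' ℓ
  haveI := module_finite_tateModule_holds W' ℓ
  -- bases and matrices
  let b := Module.finBasisOfFinrankEq ℤ_[ℓ] (W.tateModule ℓ)
    (finrank_tateModule_eq_two_holds W ℓ hℓ)
  let b' := Module.finBasisOfFinrankEq ℤ_[ℓ] (W'.tateModule ℓ)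
    (finrank_tateModule_eq_two_holds W' ℓ hℓ)
  let M : absoluteGaloisGroup ℚ →* Matrix (Fin 2) (Fin 2) ℤ_[ℓ] :=
    ((LinearMap.toMatrixAlgEquiv b).toRingEquiv.toRingHom.toMonoidHom).comp (W.galoisRepTate ℓ)
  let M' : absoluteGaloisGroup ℚ →* Matrix (Fin 2) (Fin 2) ℤ_[ℓ] :=
    ((LinearMap.toMatrixAlgEquiv b').toRingEquiv.toRingHom.toMonoidHom).comp (W'.galoisRepTate ℓ)
  have hM : ∀ g, M g = LinearMap.toMatrix b b (W.galoisRepTate ℓ g) := fun g ↦ rfl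
  have hM' : ∀ g, M' g = LinearMap.toMatrix b' b' (W'.galoisRepTate ℓ g) := fun g ↦ rfl
  have hMc : Continuous M := by
    change Continuous fun g ↦ M g
    simp_rw [hM]
    exact continuous_toMatrix_galoisRepTate ℓ W b
  have hMc' : Continuous M' := by
    change Continuous fun g ↦ M' g
    simp_rw [hM']
    exact continuous_toMatrix_galoisRepTate ℓ W' b'
  -- traces and determinants through the matrices
  have htr : ∀ g, LinearMap.trace ℤ_[ℓ] _ (W.galoisRepTate ℓ g) = (M g).trace := fun g ↦
    LinearMap.trace_eq_matrix_trace ℤ_[ℓ] b _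
  have htr' : ∀ g, LinearMap.trace ℤ_[ℓ] _ (W'.galoisRepTate ℓ g) = (M' g).trace := fun g ↦
    LinearMap.trace_eq_matrix_trace ℤ_[ℓ] b' _
  have hdet : ∀ g, LinearMap.det (W.galoisRepTate ℓ g) = (M g).det := fun g ↦
    (LinearMap.det_toMatrix b _).symm
  have hdet' : ∀ g, LinearMap.det (W'.galoisRepTate ℓ g) = (M' g).det := fun g ↦
    (LinearMap.det_toMatrix b' _).symm
  rw [htr, htr']
  refine PadicInt.ext_of_toZModPow.mp fun n ↦ ?_
  -- reduction modulo `ℓ ^ n`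
  let r : ℤ_[ℓ] →+* ZMod (ℓ ^ n) := PadicInt.toZModPow n
  let θ : absoluteGaloisGroup ℚ →* Matrix (Fin 2) (Fin 2) (ZMod (ℓ ^ n)) :=
    r.mapMatrix.toMonoidHom.comp M
  let θ' : absoluteGaloisGroup ℚ →* Matrix (Fin 2) (Fin 2) (ZMod (ℓ ^ n)) :=
    r.mapMatrix.toMonoidHom.comp M'
  have hθ : ∀ g, θ g = (M g).map r := fun g ↦ rfl
  have hθ' : ∀ g, θ' g = (M' g).map r := fun g ↦ rfl
  have hθc : Continuous θ := by
    change Continuous fun g ↦ θ g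
    simp_rw [hθ]
    exact continuous_matrix fun i j ↦
      (OneUnits.continuous_toZModPow ℓ n).comp (hMc.matrix_elem i j)
  have hθc' : Continuous θ' := by
    change Continuous fun g ↦ θ' g
    simp_rw [hθ']
    exact continuous_matrix fun i j ↦
      (OneUnits.continuous_toZModPow ℓ n).comp (hMc'.matrix_elem i j)
  let φ : absoluteGaloisGroup ℚ →*
      (Matrix (Fin 2) (Fin 2) (ZMod (ℓ ^ n)))ˣ × (Matrix (Fin 2) (Fin 2) (ZMod (ℓ ^ n)))ˣ :=
    θ.toHomUnits.prod θ'.toHomUnits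
  have hφ1 : ∀ g, ((φ g).1 : Matrix (Fin 2) (Fin 2) (ZMod (ℓ ^ n))) = θ g := fun g ↦ rfl
  have hφ2 : ∀ g, ((φ g).2 : Matrix (Fin 2) (Fin 2) (ZMod (ℓ ^ n))) = θ' g := fun g ↦ rfl
  -- the kernel of `φ` is open
  have hker :
      IsOpen ((φ.ker : Subgroup (absoluteGaloisGroup ℚ)) : Set (absoluteGaloisGroup ℚ)) := by
    have hset : ((φ.ker : Subgroup (absoluteGaloisGroup ℚ)) : Set (absoluteGaloisGroup ℚ)) =
        θ ⁻¹' {1} ∩ θ' ⁻¹' {1} := by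
      ext g
      simp only [SetLike.mem_coe, MonoidHom.mem_ker, Set.mem_inter_iff, Set.mem_preimage,
        Set.mem_singleton_iff, Prod.ext_iff, Prod.fst_one, Prod.snd_one, Units.ext_iff,
        Units.val_one, hφ1, hφ2]
    rw [hset]
    exact ((isOpen_discrete _).preimage hθc).inter ((isOpen_discrete _).preimage hθc')
  -- Frobenius' density theorem: a Frobenius in the division of `φ g` outside `S`
  obtain ⟨v, hvS, 𝔓, h𝔓, σ, hσ, k, hk, hφσ⟩ := exists_frob_eq_pow φ hker S g
  have h1 : θ σ = θ g ^ k := by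
    rw [← hφ1, ← hφ1, hφσ, Prod.pow_fst, Units.val_pow_eq_pow_val]
  have h2 : θ' σ = θ' g ^ k := by
    rw [← hφ2, ← hφ2, hφσ, Prod.pow_snd, Units.val_pow_eq_pow_val]
  have hN1 : θ g ^ orderOf (φ g) = 1 := by
    rw [← hφ1, ← Units.val_pow_eq_pow_val, ← Prod.pow_fst, pow_orderOf_eq_one, Prod.fst_one,
      Units.val_one]
  have hN2 : θ' g ^ orderOf (φ g) = 1 := by
    rw [← hφ2, ← Units.val_pow_eq_pow_val, ← Prod.pow_snd, pow_orderOf_eq_one, Prod.snd_one,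
      Units.val_one]
  -- at `σ` the reduced matrices have the same trace and determinant
  obtain ⟨hσt, hσd⟩ := h v hvS 𝔓 h𝔓 σ hσ
  rw [htr, htr'] at hσt
  rw [hdet, hdet'] at hσd
  have ht : (θ σ).trace = (θ' σ).trace := by
    rw [hθ, hθ', ← AddMonoidHom.map_trace r, ← AddMonoidHom.map_trace r, hσt]
  have hd : (θ σ).det = (θ' σ).det := by
    rw [hθ, hθ', ← RingHom.mapMatrix_apply, ← RingHom.mapMatrix_apply, ← RingHom.map_det,
      ← RingHom.map_det, hσd]
  rw [h1, h2] at ht hd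
  have key := Matrix.trace_eq_of_charpoly_pow_eq_fin_two hN1 hN2 hk ht hd
  rw [hθ, hθ', ← AddMonoidHom.map_trace r, ← AddMonoidHom.map_trace r] at key
  exact key

end Frobenius

/-! ## The assembly without Čebotarev -/

section Rat

variable (ℓ : ℕ) [Fact ℓ.Prime]

/-- **Faltings' isogeny theorem over `ℚ`, (iii) ⇒ (i), from Satz 3 and Korollar 2 only.**
Two elliptic curves over `ℚ`, given by globally minimal equations, with `a_p(W) = a_p(W')` for
all but finitely many primes are `ℚ`-isogenous — granted Satz 3 for curves over `ℚ` (`hS3`,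
semisimplicity of `V_ℓ`) and the Tate-homomorphism form of Korollar 2 (`hK2`) at one auxiliary
prime `ℓ`; Čebotarev is replaced by Frobenius' density theorem
(`trace_galoisRepTate_eq_of_frobenius_eq`). At a good prime `p ≠ ℓ` outside the exceptional set
the characteristic polynomials of Frobenius on `T_ℓ W`, `T_ℓ W'` are both `X² - a_p X + p`
(`trace_galoisRepTate_frobenius_eq_frobeniusTrace`,
`det_galoisRepTate_frobenius_of_hasGoodReductionAt_holds`); so all traces on `T_ℓ` agree, the
characters of `V_ℓ` agree (`character_rationalGaloisRepTate_eq_trace`), `V_ℓ W ≅ V_ℓ W'` by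
Satz 3 and Brauer–Nesbitt (`Representation.nonempty_equiv_of_character_eq_of_isSemisimple`),
whence a non-zero equivariant `T_ℓ W → T_ℓ W'`
(`exists_tateModule_hom_ne_zero_of_rationalGaloisRepTate_equiv`) and an isogeny (`hK2`).
[cite: Faltings1983Endlichkeit, §5 Korollar 2, (iii) ⇒ (i)] -/
theorem isIsogenous_of_finite_setOf_frobeniusTrace_ne_of_satz3_kor2
    (hS3 : ∀ W : WeierstrassCurve ℚ, isSemisimpleRepresentation_rationalGaloisRepTate W ℓ)
    (hK2 : ∀ W W' : WeierstrassCurve ℚ, isIsogenous_iff_exists_tateModule_hom_ne_zero W W' ℓ)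
    (W W' : WeierstrassCurve ℚ) [W.IsElliptic] [W'.IsElliptic] [W.IsGloballyMinimal]
    [W'.IsGloballyMinimal]
    (h : {p : ℕ | p.Prime ∧ W.frobeniusTrace p ≠ W'.frobeniusTrace p}.Finite) :
    IsIsogenous W W' := by
  classical
  -- the exceptional primes: bad for `W` or `W'`, `ℓ`, or `a_p(W) ≠ a_p(W')`
  have hbad : ((fun v : HeightOneSpectrum (𝓞 ℚ) ↦ (primesEquiv v : ℕ)) ''
      (W.badPlaces (𝓞 ℚ) ∪ W'.badPlaces (𝓞 ℚ))).Finite :=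
    ((finite_badPlaces_holds (𝓞 ℚ) W).union (finite_badPlaces_holds (𝓞 ℚ) W')).image _
  set S : Finset ℕ := (hbad.union h).toFinset ∪ {ℓ} with hSdef
  -- equal traces and determinants at the Frobenii outside `S`
  have hF : ∀ v : HeightOneSpectrum (𝓞 ℚ), (primesEquiv v : ℕ) ∉ S → ∀ 𝔓 ∈ v.primesAbove,
      ∀ σ : absoluteGaloisGroup ℚ, IsArithFrobAt (𝓞 ℚ) σ 𝔓 →
        LinearMap.trace ℤ_[ℓ] _ (W.galoisRepTate ℓ σ) =
            LinearMap.trace ℤ_[ℓ] _ (W'.galoisRepTate ℓ σ) ∧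
          LinearMap.det (W.galoisRepTate ℓ σ) = LinearMap.det (W'.galoisRepTate ℓ σ) := by
    intro v hv 𝔓 h𝔓 σ hσ
    simp only [hSdef, Finset.mem_union, Finset.mem_singleton, Set.Finite.mem_toFinset,
      Set.mem_union, Set.mem_image, Set.mem_setOf_eq, not_or, not_exists, not_and] at hv
    obtain ⟨⟨hv1, hv2⟩, hne⟩ := hv
    have hgood : W.HasGoodReductionAt v := by
      by_contra hb
      exact hv1 v (Or.inl ((mem_badPlaces_iff W v).mpr hb)) rfl
    have hgood' : W'.HasGoodReductionAt v := by
      by_contra hb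
      exact hv1 v (Or.inr ((mem_badPlaces_iff W' v).mpr hb)) rfl
    have hap : W.frobeniusTrace (primesEquiv v) = W'.frobeniusTrace (primesEquiv v) := by
      by_contra hne'
      exact hv2 (primesEquiv v).2 hne'
    have hℓv := natCast_not_mem_asIdeal_of_primesEquiv_ne (Fact.out : ℓ.Prime) hne
    refine ⟨?_, ?_⟩
    · rw [W.trace_galoisRepTate_frobenius_eq_frobeniusTrace ℓ hne hgood h𝔓 hσ,
        W'.trace_galoisRepTate_frobenius_eq_frobeniusTrace ℓ hne hgood' h𝔓 hσ, hap]
    · rw [det_galoisRepTate_frobenius_of_hasGoodReductionAt_holds W ℓ v hℓv hgood h𝔓 hσ,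
        det_galoisRepTate_frobenius_of_hasGoodReductionAt_holds W' ℓ v hℓv hgood' h𝔓 hσ]
  -- equal traces everywhere, equal characters of `V_ℓ`
  have htr := trace_galoisRepTate_eq_of_frobenius_eq ℓ W W' S hF
  haveI := module_finite_rationalTateModule_holds W ℓ
  haveI := module_finite_rationalTateModule_holds W' ℓ
  haveI : (W.rationalGaloisRepTate ℓ).IsSemisimpleRepresentation := hS3 W
  haveI : (W'.rationalGaloisRepTate ℓ).IsSemisimpleRepresentation := hS3 W'
  have hchar : (W.rationalGaloisRepTate ℓ).character = (W'.rationalGaloisRepTate ℓ).character := by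
    funext g
    rw [character_rationalGaloisRepTate_eq_trace, character_rationalGaloisRepTate_eq_trace, htr g]
  obtain ⟨e⟩ := Representation.nonempty_equiv_of_character_eq_of_isSemisimple _ _ hchar
  exact (hK2 W W').mpr (exists_tateModule_hom_ne_zero_of_rationalGaloisRepTate_equiv ℓ
    (Nat.cast_ne_zero.mpr (Fact.out : ℓ.Prime).ne_zero) e)

/-- **Assembly: `isIsogenous_iff_frobeniusTrace_eq` from Faltings' Satz 3 and Korollar 2 for
elliptic curves over `ℚ` — no Čebotarev.** Granted, at one auxiliary prime `ℓ`, Satz 3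
(`isSemisimpleRepresentation_rationalGaloisRepTate W ℓ` for all `W / ℚ`) and the
Tate-homomorphism form of Korollar 2 (`isIsogenous_iff_exists_tateModule_hom_ne_zero W W' ℓ`),
two globally minimal elliptic curves over `ℚ` are `ℚ`-isogenous iff `a_p(W) = a_p(W')` for all
but finitely many primes. "⇒": `finite_setOf_frobeniusTrace_ne_of_isIsogenous` (unconditional);
"⇐": `isIsogenous_of_finite_setOf_frobeniusTrace_ne_of_satz3_kor2`.
[cite: Faltings1983Endlichkeit, §5 Korollar 2, (i) ⇔ (iii)] -/
theorem isIsogenous_iff_frobeniusTrace_eq_of_satz3_kor2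
    (hS3 : ∀ W : WeierstrassCurve ℚ, isSemisimpleRepresentation_rationalGaloisRepTate W ℓ)
    (hK2 : ∀ W W' : WeierstrassCurve ℚ, isIsogenous_iff_exists_tateModule_hom_ne_zero W W' ℓ) :
    isIsogenous_iff_frobeniusTrace_eq := by
  intro W W' _ _ _ _
  exact ⟨finite_setOf_frobeniusTrace_ne_of_isIsogenous,
    isIsogenous_of_finite_setOf_frobeniusTrace_ne_of_satz3_kor2 ℓ hS3 hK2 W W'⟩

/-- **Assembly: `isIsogenous_iff_frobeniusTrace_eq` from Faltings' Satz 3 and Satz 4 for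
elliptic curves over `ℚ`** — the trust base of the named fact is exactly Faltings' two theorems:
Satz 3 (`isSemisimpleRepresentation_rationalGaloisRepTate W ℓ`, semisimplicity of `V_ℓ E`) and
Satz 4 / Korollar 1 (`mem_span_range_tateModule_map_of_equivariant W W' ℓ`, surjectivity of
`Hom_ℚ(E, E') ⊗ ℤ_ℓ → Hom_{Γ_ℚ}(T_ℓ E, T_ℓ E')`), at one auxiliary prime `ℓ`; Korollar 2 follows
from Satz 4 by the tree's `isIsogenous_iff_exists_tateModule_hom_ne_zero_of_satz4`, and the
printed "+ Čebotarev" is supplied by Frobenius' density theorem (a theorem of the tree).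
[cite: Faltings1983Endlichkeit, §5 Korollar 2 with Satz 3 and Satz 4] -/
theorem isIsogenous_iff_frobeniusTrace_eq_of_faltings
    (hS3 : ∀ W : WeierstrassCurve ℚ, isSemisimpleRepresentation_rationalGaloisRepTate W ℓ)
    (hS4 : ∀ W W' : WeierstrassCurve ℚ, mem_span_range_tateModule_map_of_equivariant W W' ℓ) :
    isIsogenous_iff_frobeniusTrace_eq :=
  isIsogenous_iff_frobeniusTrace_eq_of_satz3_kor2 ℓ hS3 fun W W' ↦
    isIsogenous_iff_exists_tateModule_hom_ne_zero_of_satz4 W W' ℓ (hS4 W W')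

end Rat

end WeierstrassCurve
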